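import Mathlib
import HarnessLib

/-!
# Crux U1 `KolyvaginBoundedDefectAtTwo` (stmt-BirchSwinnertonDyer-28083), LINE 17 `regular_core_rigidity`,
# toward the START FRAME stub (N3″) — generic algebra of eigenframes in a divisible `τ`-module

Width seat `bsd-line-krr2-p2` g15 (ONE READER on S1b); `--supports stmt-BirchSwinnertonDyer-28083` (helper).
THEOREMS ONLY; pure algebra; nothing here proves the start frame, S1b, U1, a rung or BSD. BSD is NOT proved.

Setting (plan `Cruxes/KolyvaginBoundedDefectAtTwo/S1-READER-g15.md`, Addendum B, steps 2–3): an abelian group `A`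
(think `Sel_{2^∞}(E/K)`), an involution `τ : A →+ A`, a `τ`-stable `2`-divisible subgroup `D` (the divisible part).
The `τ`-EIGEN-DECOMPOSITION `D = D⁺ + D⁻`, `D^± = (1 ± τ)D` (`2`-divisible, `τ = ±1` on `D^±`, `D⁺ ∩ D⁻` is `2`-torsion),
and LEVEL-`2^k` EIGENFRAMES: if `e : Fin a → D⁺[2]` is `𝔽₂`-independent and spans `D⁺[2]`, then any family `Q` in `D⁺` with
`2^(k−1) Q = e` is independent modulo `2^k` and spans `D⁺[2^k]` (`indep_of_halvings`, `mem_span_of_halvings`); such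
families exist at every level (`exists_halvings`). No structure theorem is used. [folklore]
[cite: Greenberg1999, §1–2 (cofinitely generated `ℤ_p`-modules)]
Design: no definitions; axioms `propext`, `Classical.choice`, `Quot.sound`.
-/

set_option autoImplicit false
-- the Theorems namespace of this sub repeats the summit name by design (D-0017 nested layout)
set_option linter.dupNamespace false

open Finset

namespace Summit.BirchSwinnertonDyer.BirchSwinnertonDyer.Theorems.KolyvaginAtTwo.RegularWalk

section Generic

variable {A : Type*} [AddCommGroup A] (τ : A →+ A)

/-! ### §1 The eigen-parts `(1 ± τ)D` of a `τ`-stable `2`-divisible subgroup -/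

/-- `τ = 1` on `(1 + τ)D`. [folklore] -/
theorem apply_eq_self_of_mem_map_add (hτ : ∀ x, τ (τ x) = x) (D : AddSubgroup A) {x : A}
    (hx : x ∈ D.map (AddMonoidHom.id A + τ)) : τ x = x := by
  obtain ⟨y, -, rfl⟩ := AddSubgroup.mem_map.mp hx
  simp only [AddMonoidHom.add_apply, AddMonoidHom.id_apply, map_add, hτ]
  exact add_comm _ _

/-- `τ = -1` on `(1 - τ)D`. [folklore] -/
theorem apply_eq_neg_of_mem_map_sub (hτ : ∀ x, τ (τ x) = x) (D : AddSubgroup A) {x : A}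
    (hx : x ∈ D.map (AddMonoidHom.id A - τ)) : τ x = -x := by
  obtain ⟨y, -, rfl⟩ := AddSubgroup.mem_map.mp hx
  simp only [AddMonoidHom.sub_apply, AddMonoidHom.id_apply, map_sub, hτ, neg_sub]

/-- `(1 ± τ)D ⊆ D` for a `τ`-stable `D`. [folklore] -/
theorem map_add_le (D : AddSubgroup A) (hD : ∀ x ∈ D, τ x ∈ D) : D.map (AddMonoidHom.id A + τ) ≤ D := by
  rintro _ ⟨y, hy, rfl⟩
  exact D.add_mem hy (hD y hy)

/-- `(1 - τ)D ⊆ D` for a `τ`-stable `D`. [folklore] -/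
theorem map_sub_le (D : AddSubgroup A) (hD : ∀ x ∈ D, τ x ∈ D) : D.map (AddMonoidHom.id A - τ) ≤ D := by
  rintro _ ⟨y, hy, rfl⟩
  exact D.sub_mem hy (hD y hy)

/-- `(1 ± τ)D` is `2`-divisible when `D` is. [folklore] -/
theorem divisible_map (φ : A →+ A) (D : AddSubgroup A) (hdiv : ∀ x ∈ D, ∃ y ∈ D, (2 : ℕ) • y = x) :
    ∀ x ∈ D.map φ, ∃ y ∈ D.map φ, (2 : ℕ) • y = x := by
  rintro _ ⟨z, hz, rfl⟩
  obtain ⟨y, hy, rfl⟩ := hdiv z hz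
  exact ⟨φ y, ⟨y, hy, rfl⟩, (map_nsmul φ 2 y).symm⟩

/-- Iterated halving in a `2`-divisible subgroup. [folklore] -/
theorem exists_pow_nsmul_eq (E : AddSubgroup A) (hE : ∀ x ∈ E, ∃ y ∈ E, (2 : ℕ) • y = x) {x : A} (hx : x ∈ E) (k : ℕ) :
    ∃ y ∈ E, (2 ^ k) • y = x := by
  induction k with
  | zero => exact ⟨x, hx, by rw [pow_zero, one_nsmul]⟩
  | succ k ih =>
    obtain ⟨y, hy, rfl⟩ := ih
    obtain ⟨z, hz, rfl⟩ := hE y hy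
    exact ⟨z, hz, by rw [pow_succ, mul_nsmul']⟩

/-- **`D = (1+τ)D + (1−τ)D`** for a `2`-divisible `D`: `w = 2w' = (w' + τw') + (w' − τw')`. [folklore] -/
theorem exists_add_eq_of_divisible (D : AddSubgroup A) (hdiv : ∀ x ∈ D, ∃ y ∈ D, (2 : ℕ) • y = x) {w : A} (hw : w ∈ D) :
    ∃ u ∈ D.map (AddMonoidHom.id A + τ), ∃ u' ∈ D.map (AddMonoidHom.id A - τ), w = u + u' := by
  obtain ⟨y, hy, rfl⟩ := hdiv w hw
  refine ⟨(AddMonoidHom.id A + τ) y, ⟨y, hy, rfl⟩, (AddMonoidHom.id A - τ) y, ⟨y, hy, rfl⟩, ?_⟩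
  simp only [AddMonoidHom.add_apply, AddMonoidHom.sub_apply, AddMonoidHom.id_apply, two_nsmul]
  abel

/-- **`(1+τ)D ∩ (1−τ)D` is `2`-torsion** (`τ x = x = -x`). [folklore] -/
theorem two_nsmul_eq_zero_of_mem_inf (hτ : ∀ x, τ (τ x) = x) (D : AddSubgroup A) {x : A}
    (h₁ : x ∈ D.map (AddMonoidHom.id A + τ)) (h₂ : x ∈ D.map (AddMonoidHom.id A - τ)) : (2 : ℕ) • x = 0 := by
  have e1 := apply_eq_self_of_mem_map_add τ hτ D h₁
  have e2 := apply_eq_neg_of_mem_map_sub τ hτ D h₂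
  rw [e1] at e2
  rw [two_nsmul]
  nth_rewrite 2 [e2]
  exact add_neg_cancel x

/-! ### §2 Level-`2^k` frames from an `𝔽₂`-frame of the `2`-torsion -/

/-- **Independence climbs the halving tower.** If `e` is independent modulo `2` and `2^j • Q i = e i`, then
`∑ cᵢ Qᵢ = 0 ⇒ 2^(j+1) ∣ cᵢ`. [folklore] -/
theorem indep_of_halvings {a : ℕ} (e : Fin a → A)
    (hind : ∀ c : Fin a → ℤ, ∑ i, c i • e i = 0 → ∀ i, (2 : ℤ) ∣ c i) :
    ∀ (j : ℕ) (Q : Fin a → A), (∀ i, (2 ^ j) • Q i = e i) →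
      ∀ c : Fin a → ℤ, ∑ i, c i • Q i = 0 → ∀ i, (2 : ℤ) ^ (j + 1) ∣ c i := by
  intro j
  induction j with
  | zero =>
    intro Q hQ c hc i
    rw [zero_add, pow_one]
    refine hind c ?_ i
    simpa only [pow_zero, one_nsmul] using (show ∑ i, c i • e i = ∑ i, c i • Q i from
      Finset.sum_congr rfl fun i _ ↦ by rw [← hQ i, pow_zero, one_nsmul]).trans hc
  | succ j ih =>
    intro Q hQ c hc i
    -- all coefficients are even: multiply by `2^(j+1)`
    have heven : ∀ i, (2 : ℤ) ∣ c i := by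
      refine hind c ?_
      have h : ((2 ^ (j + 1) : ℕ) : ℤ) • ∑ i, c i • Q i = 0 := by rw [hc, smul_zero]
      rw [Finset.smul_sum] at h
      rw [← h]
      exact Finset.sum_congr rfl fun i _ ↦ by rw [← hQ i, smul_comm, natCast_zsmul]
    choose c' hc' using heven
    have two_z : ∀ y : A, (2 : ℤ) • y = (2 : ℕ) • y := fun y ↦ by rw [two_zsmul, two_nsmul]
    -- the family `2 • Q` sits one level lower
    have h2Q : ∀ i, (2 ^ j) • ((2 : ℕ) • Q i) = e i := fun i ↦ by rw [← mul_nsmul', ← pow_succ, hQ i]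
    have hsum : ∑ i, c' i • ((2 : ℕ) • Q i) = 0 := by
      rw [← hc]
      exact Finset.sum_congr rfl fun i _ ↦ by rw [hc' i, mul_comm, ← smul_smul, two_z]
    have h := ih (fun i ↦ (2 : ℕ) • Q i) h2Q c' hsum i
    rw [hc' i, pow_succ, mul_comm]
    exact mul_dvd_mul_left 2 h

/-- **Spanning climbs the halving tower.** If `e ⊆ E` spans `E[2]` (`E` a subgroup) and `Q ⊆ E` with `2^j • Q i = e i`,
then every `x ∈ E` with `2^(j+1) • x = 0` is a `ℤ`-combination of the `Q i`. [folklore] -/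
theorem mem_span_of_halvings (E : AddSubgroup A) {a : ℕ} (e : Fin a → A)
    (hspan : ∀ x ∈ E, (2 : ℕ) • x = 0 → ∃ c : Fin a → ℤ, x = ∑ i, c i • e i) :
    ∀ (j : ℕ) (Q : Fin a → A), (∀ i, Q i ∈ E) → (∀ i, (2 ^ j) • Q i = e i) →
      ∀ x ∈ E, (2 ^ (j + 1)) • x = 0 → ∃ c : Fin a → ℤ, x = ∑ i, c i • Q i := by
  intro j
  induction j with
  | zero =>
    intro Q hQE hQ x hx h2x
    rw [zero_add, pow_one] at h2x
    obtain ⟨c, hc⟩ := hspan x hx h2x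
    exact ⟨c, hc.trans (Finset.sum_congr rfl fun i _ ↦ by rw [← hQ i, pow_zero, one_nsmul])⟩
  | succ j ih =>
    intro Q hQE hQ x hx h2x
    -- `2^(j+1) x ∈ E[2]` is a combination of the `e i = 2^(j+1) Q i`
    have hx' : (2 ^ (j + 1)) • x ∈ E := E.nsmul_mem hx _
    have h2 : (2 : ℕ) • ((2 ^ (j + 1)) • x) = 0 := by rw [← mul_nsmul', ← pow_succ', h2x]
    obtain ⟨c, hc⟩ := hspan _ hx' h2
    -- `x - ∑ cᵢ Qᵢ` is killed by `2^(j+1)`; apply the induction hypothesis to the family `2 • Q`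
    have h2Q : ∀ i, (2 ^ j) • ((2 : ℕ) • Q i) = e i := fun i ↦ by rw [← mul_nsmul', ← pow_succ, hQ i]
    have hrest : (2 ^ (j + 1)) • (x - ∑ i, c i • Q i) = 0 := by
      rw [nsmul_sub, hc, Finset.smul_sum, sub_eq_zero]
      exact Finset.sum_congr rfl fun i _ ↦ by rw [← hQ i, smul_comm]
    obtain ⟨d, hd⟩ := ih (fun i ↦ (2 : ℕ) • Q i) (fun i ↦ E.nsmul_mem (hQE i) _) h2Q (x - ∑ i, c i • Q i)
      (E.sub_mem hx (E.sum_mem fun i _ ↦ E.zsmul_mem (hQE i) _)) hrest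
    have two_z : ∀ y : A, (2 : ℤ) • y = (2 : ℕ) • y := fun y ↦ by rw [two_zsmul, two_nsmul]
    refine ⟨fun i ↦ c i + d i * 2, ?_⟩
    have hx_eq : x = ∑ i, c i • Q i + ∑ i, d i • ((2 : ℕ) • Q i) := by rw [← hd]; abel
    rw [hx_eq, ← Finset.sum_add_distrib]
    exact Finset.sum_congr rfl fun i _ ↦ by rw [add_zsmul, ← smul_smul, two_z]

/-- **Halvings exist at every level** in a `2`-divisible subgroup. [folklore] -/
theorem exists_halvings (E : AddSubgroup A) (hE : ∀ x ∈ E, ∃ y ∈ E, (2 : ℕ) • y = x) {a : ℕ} (e : Fin a → A)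
    (he : ∀ i, e i ∈ E) (j : ℕ) : ∃ Q : Fin a → A, (∀ i, Q i ∈ E) ∧ ∀ i, (2 ^ j) • Q i = e i := by
  have h := fun i ↦ exists_pow_nsmul_eq E hE (he i) j
  choose Q hQE hQ using h
  exact ⟨Q, hQE, hQ⟩

/-- The order of a `(k−1)`-fold halving of a non-zero `2`-torsion element is `2^k`. [folklore] -/
theorem addOrderOf_eq_of_halving {k : ℕ} (hk : 1 ≤ k) {q e : A} (he : (2 : ℕ) • e = 0) (he0 : e ≠ 0)
    (hq : (2 ^ (k - 1)) • q = e) : addOrderOf q = 2 ^ k := by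
  haveI : Fact (Nat.Prime 2) := ⟨Nat.prime_two⟩
  obtain ⟨n, rfl⟩ : ∃ n, k = n + 1 := ⟨k - 1, by omega⟩
  rw [Nat.add_sub_cancel] at hq
  refine addOrderOf_eq_prime_pow (by rw [hq]; exact he0) ?_
  rw [pow_succ', mul_nsmul', hq, he]

end Generic

end Summit.BirchSwinnertonDyer.BirchSwinnertonDyer.Theorems.KolyvaginAtTwo.RegularWalk
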